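import Mathlib
import Summits.AtomisticToContinuum.BoseEinsteinCondensation.Theses.BECStronglyRayleigh
import HarnessLib

/-!
# `PairKernelSumRule` (support item stmt-AtomisticToContinuum-9676 of route BECStronglyRayleigh):
# the pair-insertion kernel sum rule `Σ_T ‖r^T‖² = (N−1)·Σ_{x,y} γ(x,y)`

For `φ : Finset Λ → ℝ` supported on `N`-sets (`N ≥ 2`) and the two-particle insertion field
`r^T_x = Σ_y [x ∉ T, y ∉ T, x ≠ y] φ(T ∪ {x,y})` (`|T| = N − 2`), we prove the finite identity
`Σ_{|T|=N−2} Σ_x (r^T_x)² = (N−1) Σ_{x,y} γ(x,y)`, where `γ(x,x) = Σ_{S ∋ x} φ(S)²` and, for `x ≠ y`,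
`γ(x,y) = Σ_{|T'|=N−1, x,y ∉ T'} φ(T' ∪ {x}) φ(T' ∪ {y})` (for the spin-½ vector `ψ(1_S) = φ(S)` this is
`⟨ψ, S⁺_x S⁻_y ψ⟩`, so the right-hand side is `(N−1)⟨ψ, S⁺_tot S⁻_tot ψ⟩`).

Proof (pure double counting). With `q(S) = Σ_{y ∉ S} φ(S ∪ {y})` one has
`r^T_x = [x ∉ T]·q(T ∪ {x})`, and `(T, x) ↦ T ∪ {x}` (`x ∉ T`, `|T| = N−2`) is `(N−1)`-to-`1` onto the
`(N−1)`-sets, so the left-hand side is `(N−1) Σ_{|S|=N−1} q(S)²`. Expanding `q(S)²` as a double sum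
over `y, y' ∉ S` and exchanging the order of summation, the off-diagonal terms are literally
`γ(y,y')`, and the diagonal ones are `Σ_{|S|=N−1, y ∉ S} φ(S ∪ {y})² = Σ_{|S'|=N} [y ∈ S'] φ(S')²
= γ(y,y)` by the bijection `S ↦ S ∪ {y}` and the support hypothesis.

The two counting lemmas `sum_powersetCard_sum_ite_notMem` and `sum_powersetCard_ite_notMem` are
stated for a general `Fintype`; the closing theorem is
`Summit.AtomisticToContinuum.BoseEinsteinCondensation.Theorems.PairKernelSumRule_proof`.
-/

namespace Summit.AtomisticToContinuum.BoseEinsteinCondensation.Theorems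

open Finset

/-- Double counting of (`m`-subset `T`, point `y ∉ T`) against (`(m+1)`-subset `S`, point `y ∈ S`)
through `S = T ∪ {y}`: `Σ_{#T = m} Σ_{y ∉ T} g(T ∪ {y}, y) = Σ_{#S = m+1} Σ_{y ∈ S} g(S, y)`.
[folklore] -/
theorem sum_powersetCard_sum_ite_notMem {α β : Type*} [Fintype α] [DecidableEq α]
    [AddCommMonoid β] (m : ℕ) (g : Finset α → α → β) :
    ∑ T ∈ powersetCard m (univ : Finset α), ∑ y, (if y ∉ T then g (insert y T) y else 0) =
      ∑ S ∈ powersetCard (m + 1) (univ : Finset α), ∑ y ∈ S, g S y := by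
  calc ∑ T ∈ powersetCard m (univ : Finset α), ∑ y, (if y ∉ T then g (insert y T) y else 0)
      = ∑ T ∈ powersetCard m (univ : Finset α), ∑ y ∈ univ.filter (· ∉ T), g (insert y T) y :=
        sum_congr rfl fun T _ => (sum_filter _ _).symm
    _ = ∑ p ∈ (powersetCard m univ).sigma (fun T => univ.filter (· ∉ T)),
          g (insert p.2 p.1) p.2 :=
        (sum_sigma _ _ fun p : (Σ _ : Finset α, α) => g (insert p.2 p.1) p.2).symm
    _ = ∑ p ∈ (powersetCard (m + 1) univ).sigma (fun S => S), g p.1 p.2 := by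
        refine sum_nbij'
          (fun p : (Σ _ : Finset α, α) => (⟨insert p.2 p.1, p.2⟩ : Σ _ : Finset α, α))
          (fun p : (Σ _ : Finset α, α) => (⟨p.1.erase p.2, p.2⟩ : Σ _ : Finset α, α))
          ?_ ?_ ?_ ?_ ?_
        · rintro ⟨T, y⟩ h
          simp only [mem_sigma, mem_powersetCard_univ, mem_filter, mem_univ, true_and] at h ⊢
          exact ⟨by rw [card_insert_of_notMem h.2, h.1], mem_insert_self y T⟩
        · rintro ⟨S, y⟩ h
          simp only [mem_sigma, mem_powersetCard_univ, mem_filter, mem_univ, true_and] at h ⊢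
          exact ⟨by rw [card_erase_of_mem h.2, h.1]; rfl, notMem_erase y S⟩
        · rintro ⟨T, y⟩ h
          simp only [mem_sigma, mem_powersetCard_univ, mem_filter, mem_univ, true_and] at h
          simp [erase_insert h.2]
        · rintro ⟨S, y⟩ h
          simp only [mem_sigma, mem_powersetCard_univ] at h
          simp [insert_erase h.2]
        · intro p _
          rfl
    _ = ∑ S ∈ powersetCard (m + 1) univ, ∑ y ∈ S, g S y := sum_sigma _ _ _

/-- One-point form of the double count: for a fixed point `x`,
`Σ_{#T = m, x ∉ T} g(T ∪ {x}) = Σ_{#S = m+1, x ∈ S} g(S)` (bijection `T ↦ T ∪ {x}`, inverse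
`S ↦ S ∖ {x}`). [folklore] -/
theorem sum_powersetCard_ite_notMem {α β : Type*} [Fintype α] [DecidableEq α]
    [AddCommMonoid β] (m : ℕ) (x : α) (g : Finset α → β) :
    ∑ T ∈ powersetCard m (univ : Finset α), (if x ∉ T then g (insert x T) else 0) =
      ∑ S ∈ powersetCard (m + 1) (univ : Finset α), (if x ∈ S then g S else 0) := by
  rw [← sum_filter, ← sum_filter]
  refine sum_nbij' (fun T => insert x T) (fun S => S.erase x) ?_ ?_ ?_ ?_ ?_
  · intro T hT
    simp only [mem_filter, mem_powersetCard_univ] at hT ⊢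
    exact ⟨by rw [card_insert_of_notMem hT.2, hT.1], mem_insert_self x T⟩
  · intro S hS
    simp only [mem_filter, mem_powersetCard_univ] at hS ⊢
    exact ⟨by rw [card_erase_of_mem hS.2, hS.1]; rfl, notMem_erase x S⟩
  · intro T hT
    simp only [mem_filter] at hT
    exact erase_insert hT.2
  · intro S hS
    simp only [mem_filter] at hS
    exact insert_erase hS.2
  · intro T _
    rfl

/-- **Pair-kernel sum rule** (item stmt-AtomisticToContinuum-9676): for `φ` supported on `N`-sets,
`N ≥ 2`, and `r^T_x = Σ_y [x ∉ T, y ∉ T, x ≠ y] φ(T ∪ {x,y})`,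
`Σ_{|T|=N−2} Σ_x (r^T_x)² = (N−1) Σ_{x,y} γ(x,y)` with `γ(x,x) = Σ_{S ∋ x} φ(S)²` and
`γ(x,y) = Σ_{|T'|=N−1, x,y ∉ T'} φ(T' ∪ {x}) φ(T' ∪ {y})` for `x ≠ y` — pure double counting.
[folklore] -/
theorem PairKernelSumRule_proof :
    Summit.AtomisticToContinuum.BoseEinsteinCondensation.Theses.BECStronglyRayleigh.PairKernelSumRule := by
  unfold Summit.AtomisticToContinuum.BoseEinsteinCondensation.Theses.BECStronglyRayleigh.PairKernelSumRule
  intro Λ _ _ N hN φ hφ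
  dsimp only
  obtain ⟨m, rfl⟩ : ∃ m, N = m + 2 := ⟨N - 2, by omega⟩
  rw [show m + 2 - 2 = m from by omega, show m + 2 - 1 = m + 1 from by omega]
  -- the one-point insertion sum `q S = Σ_{y ∉ S} φ (S ∪ {y})`
  set q : Finset Λ → ℝ := fun S => ∑ y, if y ∉ S then φ (insert y S) else 0 with hq
  -- `r^T_x = [x ∉ T] · q (T ∪ {x})`
  have hr : ∀ (T : Finset Λ) (x : Λ),
      (∑ y, if x ∉ T ∧ y ∉ T ∧ x ≠ y then φ (insert x (insert y T)) else 0) =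
        if x ∉ T then q (insert x T) else 0 := by
    intro T x
    by_cases hx : x ∈ T
    · rw [if_neg (not_not_intro hx)]
      exact sum_eq_zero fun y _ => if_neg fun h => h.1 hx
    · rw [if_pos hx]
      refine sum_congr rfl fun y _ => ?_
      rw [Finset.insert_comm]
      refine if_congr ?_ rfl rfl
      simp only [mem_insert, not_or]
      exact ⟨fun h => ⟨fun e => h.2.2 e.symm, h.2.1⟩, fun h => ⟨hx, h.2, fun e => h.1 e.symm⟩⟩
  -- Step 1: `(T, x) ↦ T ∪ {x}` is `(m+1)`-to-`1` onto the `(m+1)`-sets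
  have hL : ∑ T ∈ powersetCard m (univ : Finset Λ), ∑ x,
        (∑ y, if x ∉ T ∧ y ∉ T ∧ x ≠ y then φ (insert x (insert y T)) else 0) ^ 2
      = ((m : ℝ) + 1) * ∑ S ∈ powersetCard (m + 1) (univ : Finset Λ), q S ^ 2 := by
    calc ∑ T ∈ powersetCard m (univ : Finset Λ), ∑ x,
          (∑ y, if x ∉ T ∧ y ∉ T ∧ x ≠ y then φ (insert x (insert y T)) else 0) ^ 2
        = ∑ T ∈ powersetCard m (univ : Finset Λ), ∑ x,
            (if x ∉ T then q (insert x T) ^ 2 else 0) := by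
          refine sum_congr rfl fun T _ => sum_congr rfl fun x _ => ?_
          rw [hr]
          split_ifs
          · exact zero_pow two_ne_zero
          · rfl
      _ = ∑ S ∈ powersetCard (m + 1) (univ : Finset Λ), ∑ x ∈ S, q S ^ 2 :=
          sum_powersetCard_sum_ite_notMem m fun S _ => q S ^ 2
      _ = ((m : ℝ) + 1) * ∑ S ∈ powersetCard (m + 1) (univ : Finset Λ), q S ^ 2 := by
          rw [mul_sum]
          refine sum_congr rfl fun S hS => ?_
          rw [sum_const, mem_powersetCard_univ.1 hS, nsmul_eq_mul]
          push_cast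
          ring
  -- Step 2: expand `q S²`, exchange sums, and identify the diagonal by the same double count
  have hR : ∑ S ∈ powersetCard (m + 1) (univ : Finset Λ), q S ^ 2 =
      ∑ x : Λ, ∑ y : Λ, (if x = y then ∑ S : Finset Λ, (if x ∈ S then φ S ^ 2 else 0)
        else ∑ T ∈ powersetCard (m + 1) (univ : Finset Λ),
          (if x ∉ T ∧ y ∉ T then φ (insert x T) * φ (insert y T) else 0)) := by
    calc ∑ S ∈ powersetCard (m + 1) (univ : Finset Λ), q S ^ 2
        = ∑ S ∈ powersetCard (m + 1) (univ : Finset Λ), ∑ x, ∑ y,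
            (if x ∉ S then φ (insert x S) else 0) * (if y ∉ S then φ (insert y S) else 0) :=
          sum_congr rfl fun S _ => by rw [sq, sum_mul_sum]
      _ = ∑ x, ∑ y, ∑ S ∈ powersetCard (m + 1) (univ : Finset Λ),
            (if x ∉ S then φ (insert x S) else 0) * (if y ∉ S then φ (insert y S) else 0) := by
          rw [sum_comm]
          exact sum_congr rfl fun x _ => sum_comm
      _ = _ := by
          refine sum_congr rfl fun x _ => sum_congr rfl fun y _ => ?_
          split_ifs with hxy
          · subst hxy
            calc ∑ S ∈ powersetCard (m + 1) (univ : Finset Λ),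
                  (if x ∉ S then φ (insert x S) else 0) * (if x ∉ S then φ (insert x S) else 0)
                = ∑ S ∈ powersetCard (m + 1) (univ : Finset Λ),
                    (if x ∉ S then φ (insert x S) ^ 2 else 0) := by
                  refine sum_congr rfl fun S _ => ?_
                  split_ifs
                  · exact mul_zero 0
                  · exact (sq _).symm
              _ = ∑ S ∈ powersetCard (m + 1 + 1) (univ : Finset Λ),
                    (if x ∈ S then φ S ^ 2 else 0) :=
                  sum_powersetCard_ite_notMem (m + 1) x fun S => φ S ^ 2
              _ = ∑ S : Finset Λ, (if x ∈ S then φ S ^ 2 else 0) := by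
                  refine sum_subset (subset_univ _) fun S _ hS => ?_
                  rw [mem_powersetCard_univ] at hS
                  simp [hφ S hS]
          · exact sum_congr rfl fun S _ => ite_zero_mul_ite_zero _ _ _ _
  rw [hL, hR]
  push_cast
  ring

end Summit.AtomisticToContinuum.BoseEinsteinCondensation.Theorems
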